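import Mathlib
import HarnessLib
import Summits.RiemannHypothesis.RiemannHypothesis.Theses.WeilParity
import Summits.RiemannHypothesis.RiemannHypothesis.Theorems.WeilGroundStateArchimedeanWindowSimpleEven
import Literature.NumberTheory.LFunctions.WeilGroundEnergyParitySplit

/-!
# Line `birth` — BC3 skeleton for the crux `EvenWinsBeyondArch` (stmt-RiemannHypothesis-15432)

Route `WeilParity` (route-RiemannHypothesis-WeilParity), crux #3 `EvenWinsBeyondArch`: on every window
`a > (log 2)/2` every odd `L²`-normalised Weil test `o` on `[-a, a]` is matched, up to any `δ > 0`, by an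
even normalised Weil test `e` on the same window with `Re Q(e) ≤ Re Q(o) + δ` — in ground-energy language
(the tree's `ε_ev = weilEvenGroundEnergy`, `ε_od = weilOddGroundEnergy`, Bombieri's `μ±(e^a)`):
`ε_ev(a) ≤ ε_od(a)` for all `a > (log 2)/2` (`evenWinsBeyondArch_of_le` below is the conversion).

## THE LINE — "no parity level-crossing": evenness is INHERITED from the archimedean window

The order of the two sector bottoms is KNOWN at the archimedean window `a₀ = (log 2)/2`:
`ε_ev(a₀) < ε_od(a₀)` strictly (tree theorem `archimedeanWindowSimpleEven_proof`, a kernel-checked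
gap certificate; restated here as `weilEvenGroundEnergy_lt_weilOddGroundEnergy_log_two_half`). Both
bottoms move continuously with the window (Bombieri 2000 Thm 5: "`μ⁺(M)`, `μ⁻(M)` are continuous
decreasing functions of `M`"). So by the intermediate value theorem the order can only be reversed at
some `a > a₀` after passing through a TIE `ε_ev(a*) = ε_od(a*)`, and a tie is a DEGENERATE bottom of the
full form (`ε = min(ε_ev, ε_od)` is then approached in two orthogonal sectors). Hence:

  continuity of the sector bottoms  +  simplicity of the bottom for every `a > a₀`  ⇒  the crux.

This is the continuity method / non-crossing rule applied ACROSS symmetry sectors: of Connes' hypothesis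
"the lowest eigenvalue of the windowed Weil form is SIMPLE and EVEN" (Connes2026Letter §6.6; route
`WeilGroundState`, crux `GroundStateSimpleEven`) the line needs only the PARITY-FREE half (simple), and
only beyond the archimedean window; EVENNESS then propagates from `a₀` along the window flow. What the
decomposition buys: the RH-bearing content of the crux is isolated in a statement of a different shape
(a spectral non-degeneracy, `stub_bottomSimpleBeyondArch`), and the RH-free remainder
(`stub_sectorContinuity`) is an M-sized adaptation of a theorem the tree already holds for the full
bottom (`Suzuki2026_thm_1_3_holds : ContinuousOn weilGroundEnergy (Ioi 0)`,
`WeilWindowSuzukiContinuityProofs.lean`: the dilation `weilDilate` preserves parity, so the same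
upper/lower semicontinuity argument runs inside each sector).

* `stub_sectorContinuity` — `ε_ev` and `ε_od` are continuous on `(0, ∞)` (Bombieri2000Weil Thm 5,
  continuity half; the monotone half is in the tree, `weilEvenGroundEnergy_antitoneOn` /
  `weilOddGroundEnergy_antitoneOn`; `WeilGroundEnergyParitySplit.lean` lists sector continuity as "not
  here"). RH-free. Size M (sector version of `continuousAt_weilGroundEnergy`). Why it might fail: only by
  a slip — right-continuity needs the UNIFORM dilation modulus over energy-bounded tests
  (`exists_weilDilate_modulus`), which is parity-blind and already proved.
* `stub_bottomSimpleBeyondArch` — for every `a > (log 2)/2` the bottom `ε(a)` of the full windowed form is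
  SIMPLE and ISOLATED in the variational, junk-free sense of the sister route: some `φ` and `δ > 0` such
  that every normalised window test orthogonal to `φ` has `Re Q ≥ ε(a) + δ` (the shape of
  `GroundStateSimpleEven` with the parity clause REMOVED). This is where the RH-content of the crux sits:
  under `¬RH`, `OffLineParityDetection` (crux #2) reverses the order at some window, so with
  `stub_sectorContinuity` and the IVT there is a tie `a* > a₀`, and a tie refutes simplicity at `a*`
  (`weilEvenGroundEnergy_ne_weilOddGroundEnergy_of_simple`, contraposed). Why it might fail: RH-strength
  as just said; and even under RH it is Connes' conjecture (prolate picture: the two sector bottoms are the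
  defects `1 − λ₀(c)`, `1 − λ₁(c)`-type quantities whose ratio grows like `c²`, refuter data odd/even
  `57 → 640 → ≈6000` on `a ∈ [0.35, 1.2]`), while for a generic one-parameter family levels of DIFFERENT
  symmetry sectors cross freely (von Neumann–Wigner) — only arithmetic rigidity forbids a tie.
  Sources: Connes2026Letter §6.4–6.6, ConnesSuijlekom2025 Thm 6.1, ConnesConsani2023 §2.1.3,
  Bombieri2000Weil Thm 5/Thm 8, Suzuki2026 (arXiv:2606.09096) §4.5.

Sorry-free infrastructure (standard axioms): `weilEvenGroundEnergy_ne_weilOddGroundEnergy_of_simple`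
(simplicity at `a` ⇒ no tie at `a`: from near-minimisers `e` even, `o` odd, the normalised combination
`(B e − A o)/√(|A|²+|B|²)`, `A = ∫ conj φ · e`, `B = ∫ conj φ · o`, is orthogonal to `φ` and has
`Re Q < ε + δ` because `Q` is parity-block-diagonal, `weilQuadratic_add_of_even_odd`),
`weilEvenGroundEnergy_lt_weilOddGroundEnergy_log_two_half` (initial strict order),
`weilEvenGroundEnergy_lt_weilOddGroundEnergy_of_pieces` (IVT propagation),
`evenWinsBeyondArch_of_le` (`ε_ev ≤ ε_od` ⇒ the junk-free crux), the composition
`evenWinsBeyondArch_of_stubs : stub₁-sig → stub₂-sig → (crux, unfolded)` and THE skeleton theorem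
`EvenWinsBeyondArch_of : EvenWinsBeyondArch` (the crux BY NAME from the two stubs; the only theorem of the
file whose head is the crux). `sorry` occurs ONLY in the two `stub_*` theorems.

Disproof used: none exists for this crux (`ledger crux ls stmt-RiemannHypothesis-15432`: no workfiles, no
`Disproof.lean`, no Negative lemmas, 2026-08-17); negatives index of the summit consulted via the route
header (empty for these decls). Dead lines: none recorded for this crux.
-/

-- `Summit.RiemannHypothesis.RiemannHypothesis`: single-conjunct summit, the duplicate component is mandated (D-0017).
set_option linter.dupNamespace false
set_option linter.unusedVariables false

noncomputable section

namespace Summit.RiemannHypothesis.RiemannHypothesis.Cruxes.EvenWinsBeyondArch.Birth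

open MeasureTheory Set Filter
open scoped Real Topology ComplexConjugate
open Literature.NumberTheory.LFunctions
open Summit.RiemannHypothesis.RiemannHypothesis.Theses.WeilParity

/-! ## The two registered stubs -/

/-- **Stub 1 — continuity of the sector bottoms in the window** (Bombieri 2000, Thm 5, continuity half,
for `μ⁺(e^a) = ε_ev(a)` and `μ⁻(e^a) = ε_od(a)`): both parity-sector ground energies of the windowed
Weil form are continuous functions of `a ∈ (0, ∞)`. RH-free; size M: run the tree's proof of
`continuousAt_weilGroundEnergy` (Suzuki 2026 Thm 1.3, `WeilWindowSuzukiContinuityProofs.lean`) inside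
each sector — the dilation `weilDilate η` maps even tests to even tests and odd to odd, and the uniform
modulus `exists_weilDilate_modulus` is parity-blind. [cite: Bombieri2000Weil, §4 Thm 5 (p. 197)] -/
theorem stub_sectorContinuity :
    ContinuousOn weilEvenGroundEnergy (Set.Ioi (0 : ℝ)) ∧
      ContinuousOn weilOddGroundEnergy (Set.Ioi (0 : ℝ)) := by
  sorry

/-- **Stub 2 — the bottom stays SIMPLE beyond the archimedean window** (parity-free half of Connes'
"lowest eigenvalue simple and even", Connes2026Letter §6.6 / ConnesSuijlekom2025 Thm 6.1 hypothesis, in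
the junk-free variational shape of route `WeilGroundState`'s `GroundStateSimpleEven` WITHOUT its parity
clause): for every `a > (log 2)/2` there are `φ` and `δ > 0` such that every `L²`-normalised Weil test on
`[-a, a]` orthogonal to `φ` has `Re Q ≥ ε(a) + δ`. RH-strength (a parity crossing forced by an off-line
zero is a degenerate bottom); under RH it is the prolate picture. [cite: Connes2026Letter, §6.6] -/
theorem stub_bottomSimpleBeyondArch :
    ∀ a : ℝ, Real.log 2 / 2 < a → ∃ φ : ℝ → ℂ, ∃ δ : ℝ, 0 < δ ∧ ∀ g : ℝ → ℂ, IsWeilTest g →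
      tsupport g ⊆ Set.Icc (-a) a → ∫ t, ‖g t‖ ^ 2 = (1 : ℝ) →
        ∫ t, starRingEnd ℂ (φ t) * g t = 0 → weilGroundEnergy a + δ ≤ (weilQuadratic g).re := by
  sorry

/-! ## Sorry-free infrastructure -/

/-- **A simple bottom cannot be a parity tie.** If at the window `a > 0` the bottom `ε(a)` is simple in
the variational sense (some `φ`, `δ > 0` with `Re Q(g) ≥ ε(a) + δ` for every normalised window test `g`
orthogonal to `φ`), then `ε_ev(a) ≠ ε_od(a)`. Proof: if `ε_ev = ε_od` then both equal `ε = min(ε_ev, ε_od)`;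
pick near-minimisers `e` (even) and `o` (odd) with `Re Q < ε + δ`; with `A = ∫ conj φ·e`, `B = ∫ conj φ·o`,
either `A = 0` or `B = 0` (then `e` or `o` itself is an admissible `g`), or the normalised combination
`g = (B e − A o)/√(|B|² + |A|²)` is a window test orthogonal to `φ` with
`Re Q(g) = (|B|² Re Q(e) + |A|² Re Q(o))/(|B|² + |A|²) < ε + δ` by parity-block-diagonality of `Q`
(`weilQuadratic_add_of_even_odd`) and `‖B e − A o‖² = |B|² + |A|²` — contradiction. [folklore] -/
theorem weilEvenGroundEnergy_ne_weilOddGroundEnergy_of_simple {a : ℝ} (ha : 0 < a) {φ : ℝ → ℂ}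
    {δ : ℝ} (hδ : 0 < δ)
    (hS : ∀ g : ℝ → ℂ, IsWeilTest g → tsupport g ⊆ Set.Icc (-a) a → ∫ t, ‖g t‖ ^ 2 = (1 : ℝ) →
      ∫ t, starRingEnd ℂ (φ t) * g t = 0 → weilGroundEnergy a + δ ≤ (weilQuadratic g).re) :
    weilEvenGroundEnergy a ≠ weilOddGroundEnergy a := by
  intro htie
  have hmin := weilGroundEnergy_eq_min_even_odd a
  have hεev : weilGroundEnergy a = weilEvenGroundEnergy a := by rw [hmin, htie, min_self]
  have hεod : weilGroundEnergy a = weilOddGroundEnergy a := by rw [hεev, htie]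
  -- near-minimisers in each sector
  obtain ⟨x, hxS, hx⟩ := exists_lt_of_csInf_lt (weilWindowSphereValues_even_nonempty ha)
    (show sInf (weilWindowSphereValues (fun g ↦ ∀ t, g (-t) = g t) a) < weilGroundEnergy a + δ by
      rw [← weilEvenGroundEnergy_eq_sInf, ← hεev]; linarith)
  obtain ⟨e, he, hes, hev, hen, rfl⟩ := hxS
  obtain ⟨y, hyS, hy⟩ := exists_lt_of_csInf_lt (weilWindowSphereValues_odd_nonempty ha)
    (show sInf (weilWindowSphereValues (fun g ↦ ∀ t, g (-t) = -g t) a) < weilGroundEnergy a + δ by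
      rw [← weilOddGroundEnergy_eq_sInf, ← hεod]; linarith)
  obtain ⟨o, ho, hos, hodd, hon, rfl⟩ := hyS
  set A : ℂ := ∫ t, starRingEnd ℂ (φ t) * e t with hA
  set B : ℂ := ∫ t, starRingEnd ℂ (φ t) * o t with hB
  by_cases hB0 : B = 0
  · have h := hS o ho hos hon hB0
    linarith
  by_cases hA0 : A = 0
  · have h := hS e he hes hen hA0
    linarith
  -- both overlaps are nonzero, hence the integrands are integrable (no junk)
  have hIe : Integrable (fun t ↦ starRingEnd ℂ (φ t) * e t) := by
    by_contra hI
    exact hA0 (integral_undef hI)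
  have hIo : Integrable (fun t ↦ starRingEnd ℂ (φ t) * o t) := by
    by_contra hI
    exact hB0 (integral_undef hI)
  have hBn : 0 < ‖B‖ := norm_pos_iff.mpr hB0
  have hAn : 0 < ‖A‖ := norm_pos_iff.mpr hA0
  set N : ℝ := ‖B‖ ^ 2 + ‖A‖ ^ 2 with hN
  have hNpos : 0 < N := add_pos (pow_pos hBn 2) (pow_pos hAn 2)
  set c : ℝ := (Real.sqrt N)⁻¹ with hc
  have hcc : c * c = N⁻¹ := by
    rw [hc, ← mul_inv, Real.mul_self_sqrt hNpos.le]
  -- the combination h = B e − A o and its normalisation g = c h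
  set h : ℝ → ℂ := fun t ↦ B * e t - A * o t with hh
  set g : ℝ → ℂ := fun t ↦ (c : ℂ) * h t with hg
  have hht : IsWeilTest h := (he.const_mul B).sub' (ho.const_mul A)
  have hgt : IsWeilTest g := hht.const_mul (c : ℂ)
  -- support
  have hgs : tsupport g ⊆ Set.Icc (-a) a := by
    refine closure_minimal (fun t ht ↦ ?_) isClosed_Icc
    by_contra hta
    apply ht
    have he0 : e t = 0 := image_eq_zero_of_notMem_tsupport fun h' ↦ hta (hes h')
    have ho0 : o t = 0 := image_eq_zero_of_notMem_tsupport fun h' ↦ hta (hos h')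
    simp [hg, hh, he0, ho0]
  -- parity parts of h
  have hE : ∀ t, (h t + h (-t)) / 2 = B * e t := fun t ↦ by
    simp only [hh, hev t, hodd t]; ring
  have hO : ∀ t, (h t - h (-t)) / 2 = -A * o t := fun t ↦ by
    simp only [hh, hev t, hodd t]; ring
  -- norm of h
  have hnormh : ∫ t, ‖h t‖ ^ 2 = N := by
    have hsplit := integral_norm_sq_evenPart_add_oddPart hht
    simp_rw [hE, hO] at hsplit
    have h1 : ∫ t, ‖B * e t‖ ^ 2 = ‖B‖ ^ 2 := by
      simp only [norm_mul, mul_pow]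
      rw [integral_const_mul, hen, mul_one]
    have h2 : ∫ t, ‖-A * o t‖ ^ 2 = ‖A‖ ^ 2 := by
      simp only [norm_mul, norm_neg, mul_pow]
      rw [integral_const_mul, hon, mul_one]
    rw [← hsplit, h1, h2]
  -- norm of g
  have hgn : ∫ t, ‖g t‖ ^ 2 = (1 : ℝ) := by
    simp only [hg, norm_mul, mul_pow, Complex.norm_real, Real.norm_eq_abs, sq_abs]
    rw [integral_const_mul, hnormh, sq, hcc, inv_mul_cancel₀ hNpos.ne']
  -- orthogonality to φ
  have hgφ : ∫ t, starRingEnd ℂ (φ t) * g t = 0 := by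
    have hpt : ∀ t, starRingEnd ℂ (φ t) * g t =
        (c : ℂ) * B * (starRingEnd ℂ (φ t) * e t) - (c : ℂ) * A * (starRingEnd ℂ (φ t) * o t) := by
      intro t
      simp only [hg, hh]
      ring
    simp_rw [hpt]
    rw [integral_sub (hIe.const_mul _) (hIo.const_mul _), integral_const_mul, integral_const_mul,
      ← hA, ← hB]
    ring
  -- the value of Q on h and g
  have hQh : (weilQuadratic h).re = ‖B‖ ^ 2 * (weilQuadratic e).re + ‖A‖ ^ 2 * (weilQuadratic o).re := by
    have hsum : h = (fun t ↦ B * e t) + fun t ↦ -A * o t := by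
      funext t
      simp only [hh, Pi.add_apply]
      ring
    rw [hsum, weilQuadratic_add_of_even_odd (he.const_mul B) (ho.const_mul (-A))
      (fun t ↦ by simp only [hev t]) (fun t ↦ by simp only [hodd t]; ring),
      Complex.add_re, weilQuadratic_const_mul, weilQuadratic_const_mul, Complex.re_ofReal_mul,
      Complex.re_ofReal_mul, Complex.normSq_neg, Complex.normSq_eq_norm_sq, Complex.normSq_eq_norm_sq]
  have hQg : (weilQuadratic g).re = N⁻¹ * (weilQuadratic h).re := by
    rw [hg, weilQuadratic_const_mul, Complex.re_ofReal_mul, Complex.normSq_ofReal, hcc]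
  have hlt : (weilQuadratic h).re < N * (weilGroundEnergy a + δ) := by
    have h1 : ‖B‖ ^ 2 * (weilQuadratic e).re < ‖B‖ ^ 2 * (weilGroundEnergy a + δ) :=
      mul_lt_mul_of_pos_left hx (pow_pos hBn 2)
    have h2 : ‖A‖ ^ 2 * (weilQuadratic o).re ≤ ‖A‖ ^ 2 * (weilGroundEnergy a + δ) :=
      mul_le_mul_of_nonneg_left hy.le (sq_nonneg _)
    rw [hQh, hN]
    linarith
  have hQg_lt : (weilQuadratic g).re < weilGroundEnergy a + δ := by
    rw [hQg]
    have h := mul_lt_mul_of_pos_left hlt (inv_pos.mpr hNpos)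
    rwa [inv_mul_cancel_left₀ hNpos.ne'] at h
  -- simplicity applied to g
  have hge := hS g hgt hgs hgn hgφ
  linarith

/-- **Initial strict order at the archimedean window**: `ε_ev((log 2)/2) < ε_od((log 2)/2)`. From the
tree theorem `archimedeanWindowSimpleEven_proof` (route `WeilGroundState`, item
`ArchimedeanWindowSimpleEven`, kernel-checked gap certificate): every normalised ODD window test has
`Re Q ≥ ε + δ`, so `ε_od ≥ ε + δ > ε = min(ε_ev, ε_od)`, whence `ε = ε_ev < ε_od`. [folklore] -/
theorem weilEvenGroundEnergy_lt_weilOddGroundEnergy_log_two_half :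
    weilEvenGroundEnergy (Real.log 2 / 2) < weilOddGroundEnergy (Real.log 2 / 2) := by
  have ha : 0 < Real.log 2 / 2 := div_pos (Real.log_pos one_lt_two) two_pos
  obtain ⟨φ, δ, hδ, hgap⟩ :=
    Summit.RiemannHypothesis.RiemannHypothesis.Theorems.WeilGroundState.archimedeanWindowSimpleEven_proof
  have hodd : weilGroundEnergy (Real.log 2 / 2) + δ ≤ weilOddGroundEnergy (Real.log 2 / 2) :=
    le_weilOddGroundEnergy_of_forall ha fun g hg hs ho hn ↦ hgap g hg hs hn (Or.inl ho)
  have hmin := weilGroundEnergy_eq_min_even_odd (Real.log 2 / 2)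
  rcases min_cases (weilEvenGroundEnergy (Real.log 2 / 2)) (weilOddGroundEnergy (Real.log 2 / 2)) with
    ⟨h1, h2⟩ | ⟨h1, h2⟩
  · rw [hmin, h1] at hodd
    linarith
  · rw [hmin, h1] at hodd
    linarith

/-- **IVT propagation** (the continuity method across parity sectors): if the sector bottoms are
continuous on `(0, ∞)` and never tie beyond the archimedean window, then the strict order
`ε_ev < ε_od` known at `a₀ = (log 2)/2` persists for every `a > a₀` — a reversal at `a` would force a zero
of the continuous function `ε_od − ε_ev` on `[a₀, a]`, not at `a₀`, i.e. a tie beyond `a₀`. [folklore] -/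
theorem weilEvenGroundEnergy_lt_weilOddGroundEnergy_of_pieces
    (hcont : ContinuousOn weilEvenGroundEnergy (Set.Ioi (0 : ℝ)) ∧
      ContinuousOn weilOddGroundEnergy (Set.Ioi (0 : ℝ)))
    (hne : ∀ a : ℝ, Real.log 2 / 2 < a → weilEvenGroundEnergy a ≠ weilOddGroundEnergy a)
    {a : ℝ} (ha : Real.log 2 / 2 < a) :
    weilEvenGroundEnergy a < weilOddGroundEnergy a := by
  have ha₀pos : 0 < Real.log 2 / 2 := div_pos (Real.log_pos one_lt_two) two_pos
  set d : ℝ → ℝ := fun x ↦ weilOddGroundEnergy x - weilEvenGroundEnergy x with hd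
  have hsub : Set.Icc (Real.log 2 / 2) a ⊆ Set.Ioi 0 := fun x hx ↦ lt_of_lt_of_le ha₀pos hx.1
  have hdcont : ContinuousOn d (Set.Icc (Real.log 2 / 2) a) :=
    (hcont.2.mono hsub).sub (hcont.1.mono hsub)
  have hd₀ : 0 < d (Real.log 2 / 2) :=
    sub_pos.mpr weilEvenGroundEnergy_lt_weilOddGroundEnergy_log_two_half
  have hda : d a ≠ 0 := by
    intro h0
    apply hne a ha
    simp only [hd] at h0
    linarith
  rcases lt_or_gt_of_ne hda with hneg | hpos
  · exfalso
    obtain ⟨c, hc, hdc⟩ := intermediate_value_Icc' ha.le hdcont ⟨hneg.le, hd₀.le⟩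
    have hca₀ : c ≠ Real.log 2 / 2 := by
      intro hEq
      rw [hEq] at hdc
      linarith
    have hc' : Real.log 2 / 2 < c := lt_of_le_of_ne hc.1 (Ne.symm hca₀)
    apply hne c hc'
    simp only [hd] at hdc
    linarith
  · exact sub_pos.mp hpos

/-- **From `ε_ev ≤ ε_od` to the junk-free crux.** For `a > (log 2)/2` (so `a > 0`: both sector spheres are
nonempty and bounded below), `ε_ev(a) ≤ ε_od(a)` yields, for every odd normalised window test `o` and
`δ > 0`, an even normalised window test `e` with `Re Q(e) ≤ Re Q(o) + δ`: `ε_ev(a) ≤ ε_od(a) ≤ Re Q(o)`,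
and `ε_ev(a)` is an infimum over a nonempty set. The conclusion is `EvenWinsBeyondArch` unfolded (the
skeleton theorem below is the only one concluding the crux by name). [folklore] -/
theorem evenWinsBeyondArch_of_le
    (h : ∀ a : ℝ, Real.log 2 / 2 < a → weilEvenGroundEnergy a ≤ weilOddGroundEnergy a) :
    ∀ a : ℝ, Real.log 2 / 2 < a → ∀ o : ℝ → ℂ, Literature.NumberTheory.LFunctions.IsWeilTest o →
      tsupport o ⊆ Set.Icc (-a) a → (∀ t, o (-t) = -o t) → ∫ t, ‖o t‖ ^ 2 = (1 : ℝ) → ∀ δ : ℝ, 0 < δ →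
        ∃ e : ℝ → ℂ, Literature.NumberTheory.LFunctions.IsWeilTest e ∧ tsupport e ⊆ Set.Icc (-a) a ∧
          (∀ t, e (-t) = e t) ∧ ∫ t, ‖e t‖ ^ 2 = (1 : ℝ) ∧
          (Literature.NumberTheory.LFunctions.weilQuadratic e).re ≤
            (Literature.NumberTheory.LFunctions.weilQuadratic o).re + δ := by
  intro a ha o ho hos hodd hon δ hδ
  have ha0 : 0 < a := lt_trans (div_pos (Real.log_pos one_lt_two) two_pos) ha
  have hod : weilOddGroundEnergy a ≤ (weilQuadratic o).re := weilOddGroundEnergy_le ho hos hodd hon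
  have hlt : sInf (weilWindowSphereValues (fun g ↦ ∀ t, g (-t) = g t) a) < (weilQuadratic o).re + δ := by
    rw [← weilEvenGroundEnergy_eq_sInf]
    linarith [h a ha]
  obtain ⟨x, hxS, hx⟩ := exists_lt_of_csInf_lt (weilWindowSphereValues_even_nonempty ha0) hlt
  obtain ⟨e, he, hes, hev, hen, rfl⟩ := hxS
  exact ⟨e, he, hes, hev, hen, hx.le⟩

/-! ## The composition: the two stubs prove the crux BY NAME -/

/-- **Composition with explicit hypotheses** (the BC3 shape `stub₁-sig → stub₂-sig → crux`, the conclusion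
written as the crux's unfolding so that `EvenWinsBeyondArch_of` below is the file's ONLY theorem whose
head is the crux name, as `ledger skeleton check` requires). Sector continuity (stub 1) and simplicity
beyond the archimedean window (stub 2, turned into "no tie" by
`weilEvenGroundEnergy_ne_weilOddGroundEnergy_of_simple`) give `ε_ev < ε_od` on `((log 2)/2, ∞)` by the
IVT propagation from the certified archimedean window, and `evenWinsBeyondArch_of_le` converts.
Sorry-free, standard axioms. [folklore] -/
theorem evenWinsBeyondArch_of_stubs
    (h₁ : ContinuousOn weilEvenGroundEnergy (Set.Ioi (0 : ℝ)) ∧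
      ContinuousOn weilOddGroundEnergy (Set.Ioi (0 : ℝ)))
    (h₂ : ∀ a : ℝ, Real.log 2 / 2 < a → ∃ φ : ℝ → ℂ, ∃ δ : ℝ, 0 < δ ∧ ∀ g : ℝ → ℂ, IsWeilTest g →
      tsupport g ⊆ Set.Icc (-a) a → ∫ t, ‖g t‖ ^ 2 = (1 : ℝ) →
        ∫ t, starRingEnd ℂ (φ t) * g t = 0 → weilGroundEnergy a + δ ≤ (weilQuadratic g).re) :
    ∀ a : ℝ, Real.log 2 / 2 < a → ∀ o : ℝ → ℂ, Literature.NumberTheory.LFunctions.IsWeilTest o →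
      tsupport o ⊆ Set.Icc (-a) a → (∀ t, o (-t) = -o t) → ∫ t, ‖o t‖ ^ 2 = (1 : ℝ) → ∀ δ : ℝ, 0 < δ →
        ∃ e : ℝ → ℂ, Literature.NumberTheory.LFunctions.IsWeilTest e ∧ tsupport e ⊆ Set.Icc (-a) a ∧
          (∀ t, e (-t) = e t) ∧ ∫ t, ‖e t‖ ^ 2 = (1 : ℝ) ∧
          (Literature.NumberTheory.LFunctions.weilQuadratic e).re ≤
            (Literature.NumberTheory.LFunctions.weilQuadratic o).re + δ := by
  have hne : ∀ a : ℝ, Real.log 2 / 2 < a → weilEvenGroundEnergy a ≠ weilOddGroundEnergy a := by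
    intro a ha
    have ha0 : 0 < a := lt_trans (div_pos (Real.log_pos one_lt_two) two_pos) ha
    obtain ⟨φ, δ, hδ, hS⟩ := h₂ a ha
    exact weilEvenGroundEnergy_ne_weilOddGroundEnergy_of_simple ha0 hδ hS
  exact evenWinsBeyondArch_of_le fun a ha ↦
    (weilEvenGroundEnergy_lt_weilOddGroundEnergy_of_pieces h₁ hne ha).le

/-- **THE SKELETON THEOREM.** The crux `Summit.RiemannHypothesis.RiemannHypothesis.Theses.WeilParity.EvenWinsBeyondArch`,
concluded BY NAME from the two DECLARED stubs `stub_sectorContinuity` and `stub_bottomSimpleBeyondArch`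
(the only `sorry`s of the file) through the sorry-free composition `evenWinsBeyondArch_of_stubs`.
[folklore] -/
theorem EvenWinsBeyondArch_of :
    Summit.RiemannHypothesis.RiemannHypothesis.Theses.WeilParity.EvenWinsBeyondArch :=
  evenWinsBeyondArch_of_stubs stub_sectorContinuity stub_bottomSimpleBeyondArch

end Summit.RiemannHypothesis.RiemannHypothesis.Cruxes.EvenWinsBeyondArch.Birth
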